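import Summits.Ventures.YMGap.FlowData.RectTubeTransferOperator
import Summits.Ventures.YMGap.Census.TwistCensusObjects
import HarnessLib

/-!
# Venture YMGap, track Y3 FLOW-DATA — CENTRE RESCALINGS of a slice (`a ↦ γ·a`, `γ` a central link field) and an abstract
# KERNEL-CONJUGATION lemma (kernels related by a measure-preserving bijection have equal operator norms)

HONEST FRAMING: venture file of the cell `pub-ymgap` (QuantumFields programme), track Y3 (FLOW-DATA); a TOOLS file for the
rectangular tube (`FlowData/RectTubeTransferOperator.lean`).  Finite spatial torus; no number, no row, nothing about `L → ∞`,
the continuum or a mass gap.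

* `comp_kernelOp_eq_of_kernel_comp` — if `K(σ a, σ b) = K'(a, b)` for a measure-preserving `σ`, then `V_σ ∘ A = A' ∘ V_σ` for the
  kernel operators `A, A'` and the composition operator `V_σ ψ = ψ ∘ σ`; **`norm_kernelOp_eq_of_conj`** — if moreover `σ` has a
  measure-preserving two-sided inverse, `‖A'‖ = ‖A‖` (the common step behind translation, axis, flux-twist and magnetic-twist
  covariances of tube operators);
* `rectLinkRescale γ a = (γ_e · a_e)_e` (one definition), `measurePreserving_rectLinkRescale`,
  `rectPlaquetteHolonomy_linkRescale` (`U_q(γ·a) = U_q(γ)·U_q(a)` for central `γ` — the COBOUNDARY `U_q(γ)` appears),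
  `rectElecSum_linkRescale` (temporal plaquettes are blind to a simultaneous central rescaling of both slices);
* for a FLAT central field (`U_q(γ) = 1` for all plaquettes `q` — a centre 1-cocycle, e.g. 't Hooft's electric twist
  `rectFluxTwistPrefactor z s`): `rectMagSum_linkRescale_of_flat`, `rectSliceKernel_linkRescale_of_flat` (`K(γ·a, γ·b) = K(a, b)`),
  **`rectLinkRescaleOp_comp_rectTubeTransferOperator`** (`V_γ ∘ T = T ∘ V_γ`) — every centre cocycle is a symmetry of the tube,
  generalising `rectSliceKernel_fluxTwist`.

References: G. 't Hooft, Nucl. Phys. B 153 (1979) 141 [cite: tHooft1979Flux]; M. Lüscher, Commun. Math. Phys. 54 (1977) 283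
[cite: Luscher1977]; M. Reed, B. Simon I (1980) §VI [cite: ReedSimonI1980, §VI].
-/

noncomputable section

open scoped BigOperators ENNReal
open MeasureTheory Filter Function
open Literature.MathematicalPhysics.QuantumFieldTheory Literature.Analysis.OperatorTheory
open Literature.MathematicalPhysics.QuantumLattice (RectTorusSite)
open Literature.Barriers.QuantumFields (central_collect)
open Summit.Ventures.YMGap.Census (RectPlaquette rectPlaquetteHolonomy)

namespace Summit.Ventures.YMGap.FlowData

/-! ### Abstract: kernels related by a measure-preserving bijection -/

section Conj

variable {X : Type*} [MeasurableSpace X] {μ : Measure X}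

/-- **Intertwining**: if `K (σ a) (σ b) = K' a b` for a measure-preserving `σ`, then `V_σ ∘ A = A' ∘ V_σ` for the kernel
operators `A, A'` of `K, K'` and the composition operator `V_σ ψ = ψ ∘ σ`. [folklore] -/
theorem comp_kernelOp_eq_of_kernel_comp {σ : X → X} (hσ : MeasurePreserving σ μ μ) {K K' : X → X → ℝ}
    (hK : StronglyMeasurable (uncurry K)) (hKK : ∀ a b, K (σ a) (σ b) = K' a b) {A A' : Lp ℝ 2 μ →L[ℝ] Lp ℝ 2 μ}
    (hA : ∀ φ : Lp ℝ 2 μ, (A φ : X → ℝ) =ᵐ[μ] fun x => ∫ y, K x y * φ y ∂μ)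
    (hA' : ∀ φ : Lp ℝ 2 μ, (A' φ : X → ℝ) =ᵐ[μ] fun x => ∫ y, K' x y * φ y ∂μ) :
    ((Lp.compMeasurePreservingₗᵢ ℝ σ hσ).toContinuousLinearMap).comp A =
      A'.comp (Lp.compMeasurePreservingₗᵢ ℝ σ hσ).toContinuousLinearMap := by
  refine ContinuousLinearMap.ext fun φ => Lp.ext ?_
  rw [ContinuousLinearMap.comp_apply, ContinuousLinearMap.comp_apply]
  have hV : ∀ ψ : Lp ℝ 2 μ, ((Lp.compMeasurePreservingₗᵢ ℝ σ hσ).toContinuousLinearMap ψ : X → ℝ) =ᵐ[μ]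
      (ψ : X → ℝ) ∘ σ := fun ψ => Lp.coeFn_compMeasurePreserving ψ hσ
  have hL : ((Lp.compMeasurePreservingₗᵢ ℝ σ hσ).toContinuousLinearMap (A φ) : X → ℝ) =ᵐ[μ]
      fun a => ∫ b, K (σ a) b * φ b ∂μ :=
    (hV _).trans (hσ.quasiMeasurePreserving.ae_eq_comp (hA φ))
  have hR : (A' ((Lp.compMeasurePreservingₗᵢ ℝ σ hσ).toContinuousLinearMap φ) : X → ℝ) =ᵐ[μ]
      fun a => ∫ b, K (σ a) b * φ b ∂μ := by
    refine (hA' _).trans (Eventually.of_forall fun a => ?_)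
    have h1 : ∫ b, K' a b * ((Lp.compMeasurePreservingₗᵢ ℝ σ hσ).toContinuousLinearMap φ : X → ℝ) b ∂μ =
        ∫ b, K' a b * φ (σ b) ∂μ := by
      refine integral_congr_ae ?_
      filter_upwards [hV φ] with b hb
      rw [hb, Function.comp_apply]
    have h2 : ∫ b, K' a b * φ (σ b) ∂μ = ∫ b, (fun c => K (σ a) c * φ c) (σ b) ∂μ := by
      refine integral_congr_ae (Eventually.of_forall fun b => ?_)
      simp only [hKK]
    have hg : AEStronglyMeasurable (fun c => K (σ a) c * φ c) μ :=
      (hK.comp_measurable (measurable_const.prodMk measurable_id)).aestronglyMeasurable.mul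
        (Lp.aestronglyMeasurable φ)
    have h3 : ∫ b, (fun c => K (σ a) c * φ c) (σ b) ∂μ = ∫ c, K (σ a) c * φ c ∂μ := by
      have hg' : AEStronglyMeasurable (fun c => K (σ a) c * φ c) (Measure.map σ μ) := by rw [hσ.map_eq]; exact hg
      have := integral_map hσ.measurable.aemeasurable hg'
      rw [hσ.map_eq] at this
      exact this.symm
    dsimp only
    rw [h1, h2, h3]
  exact hL.trans hR.symm

/-- **Composition operators of mutually inverse measure-preserving maps compose to `1`.** [folklore] -/
theorem compMeasurePreserving_comp_eq_one {τ τ' : X → X} (hτ : MeasurePreserving τ μ μ) (hτ' : MeasurePreserving τ' μ μ)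
    (hid : ∀ x, τ' (τ x) = x) :
    ((Lp.compMeasurePreservingₗᵢ ℝ τ hτ).toContinuousLinearMap : Lp ℝ 2 μ →L[ℝ] Lp ℝ 2 μ).comp
      ((Lp.compMeasurePreservingₗᵢ ℝ τ' hτ').toContinuousLinearMap : Lp ℝ 2 μ →L[ℝ] Lp ℝ 2 μ) = 1 := by
  refine ContinuousLinearMap.ext fun ψ => Lp.ext ?_
  rw [ContinuousLinearMap.comp_apply, ContinuousLinearMap.one_def, ContinuousLinearMap.id_apply]
  set W' : Lp ℝ 2 μ →L[ℝ] Lp ℝ 2 μ := (Lp.compMeasurePreservingₗᵢ ℝ τ' hτ').toContinuousLinearMap with hW'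
  have hW'ae : ((W' ψ : Lp ℝ 2 μ) : X → ℝ) =ᵐ[μ] (ψ : X → ℝ) ∘ τ' := Lp.coeFn_compMeasurePreserving ψ hτ'
  have ha : (((Lp.compMeasurePreservingₗᵢ ℝ τ hτ).toContinuousLinearMap : Lp ℝ 2 μ →L[ℝ] Lp ℝ 2 μ) (W' ψ) : X → ℝ)
      =ᵐ[μ] ((W' ψ : Lp ℝ 2 μ) : X → ℝ) ∘ τ := Lp.coeFn_compMeasurePreserving (W' ψ) hτ
  have hb : ((W' ψ : Lp ℝ 2 μ) : X → ℝ) ∘ τ =ᵐ[μ] ((ψ : X → ℝ) ∘ τ') ∘ τ :=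
    hτ.quasiMeasurePreserving.ae_eq_comp hW'ae
  have hc : ((ψ : X → ℝ) ∘ τ') ∘ τ = (ψ : X → ℝ) := by
    funext x
    simp only [Function.comp_apply, hid]
  rw [hc] at hb
  exact ha.trans hb

/-- **Equal norms**: if `K (σ a) (σ b) = K' a b` and `σ` has a measure-preserving two-sided inverse `σ'`, then `‖A'‖ = ‖A‖`
(`A' = V_σ A V_{σ'}`, `A = V_{σ'} A' V_σ`, composition operators have norm `≤ 1`). [cite: ReedSimonI1980, §VI] -/
theorem norm_kernelOp_eq_of_conj {σ σ' : X → X} (hσ : MeasurePreserving σ μ μ) (hσ' : MeasurePreserving σ' μ μ)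
    (h1 : ∀ x, σ' (σ x) = x) (h2 : ∀ x, σ (σ' x) = x) {K K' : X → X → ℝ}
    (hK : StronglyMeasurable (uncurry K)) (hKK : ∀ a b, K (σ a) (σ b) = K' a b) {A A' : Lp ℝ 2 μ →L[ℝ] Lp ℝ 2 μ}
    (hA : ∀ φ : Lp ℝ 2 μ, (A φ : X → ℝ) =ᵐ[μ] fun x => ∫ y, K x y * φ y ∂μ)
    (hA' : ∀ φ : Lp ℝ 2 μ, (A' φ : X → ℝ) =ᵐ[μ] fun x => ∫ y, K' x y * φ y ∂μ) : ‖A'‖ = ‖A‖ := by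
  set V : Lp ℝ 2 μ →L[ℝ] Lp ℝ 2 μ := (Lp.compMeasurePreservingₗᵢ ℝ σ hσ).toContinuousLinearMap with hVdef
  set V' : Lp ℝ 2 μ →L[ℝ] Lp ℝ 2 μ := (Lp.compMeasurePreservingₗᵢ ℝ σ' hσ').toContinuousLinearMap with hV'def
  have hcomm : V.comp A = A'.comp V := comp_kernelOp_eq_of_kernel_comp hσ hK hKK hA hA'
  have hnV : ‖V‖ ≤ 1 := ContinuousLinearMap.opNorm_le_bound _ zero_le_one fun ψ => by
    rw [one_mul]; exact (Lp.norm_compMeasurePreserving ψ hσ).le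
  have hnV' : ‖V'‖ ≤ 1 := ContinuousLinearMap.opNorm_le_bound _ zero_le_one fun ψ => by
    rw [one_mul]; exact (Lp.norm_compMeasurePreserving ψ hσ').le
  have hVV' : V.comp V' = 1 := compMeasurePreserving_comp_eq_one hσ hσ' h1
  have hV'V : V'.comp V = 1 := compMeasurePreserving_comp_eq_one hσ' hσ h2
  have hA'eq : A' = (V.comp A).comp V' := by
    rw [hcomm, ContinuousLinearMap.comp_assoc, hVV', ContinuousLinearMap.one_def, ContinuousLinearMap.comp_id]
  have hAeq : A = V'.comp (A'.comp V) := by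
    rw [← hcomm, ← ContinuousLinearMap.comp_assoc, hV'V, ContinuousLinearMap.one_def, ContinuousLinearMap.id_comp]
  refine le_antisymm ?_ ?_
  · calc ‖A'‖ = ‖(V.comp A).comp V'‖ := by rw [← hA'eq]
      _ ≤ ‖V‖ * ‖A‖ * ‖V'‖ := (ContinuousLinearMap.opNorm_comp_le _ _).trans
          (mul_le_mul_of_nonneg_right (ContinuousLinearMap.opNorm_comp_le _ _) (norm_nonneg _))
      _ ≤ 1 * ‖A‖ * 1 := by gcongr
      _ = ‖A‖ := by ring
  · calc ‖A‖ = ‖V'.comp (A'.comp V)‖ := by rw [← hAeq]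
      _ ≤ ‖V'‖ * (‖A'‖ * ‖V‖) := (ContinuousLinearMap.opNorm_comp_le _ _).trans
          (mul_le_mul_of_nonneg_left (ContinuousLinearMap.opNorm_comp_le _ _) (norm_nonneg _))
      _ ≤ 1 * (‖A'‖ * 1) := by gcongr
      _ = ‖A'‖ := by ring

end Conj

/-! ### Centre rescalings of a slice -/

section Rescale

variable {G : Type*} [Group G] {n k : ℕ} (ρ : G →* Matrix (Fin n) (Fin n) ℂ) {Ls : Fin k → ℕ}

/-- **Left multiplication of every link by a link field `γ`** (a centre "gauge" rescaling when `γ` is central; 't Hooft's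
electric twist `rectFluxTwist z s` is the case `γ = rectFluxTwistPrefactor z s`). -/
def rectLinkRescale (γ : RectSlice Ls G) (a : RectSlice Ls G) : RectSlice Ls G := fun e => γ e * a e

/-- Pointwise formula. [folklore] -/
@[simp] theorem rectLinkRescale_apply (γ a : RectSlice Ls G) (e : RectTorusSite Ls × Fin k) :
    rectLinkRescale γ a e = γ e * a e := rfl

/-- `γ⁻¹·(γ·a) = a`. [folklore] -/
theorem rectLinkRescale_inv_rectLinkRescale (γ a : RectSlice Ls G) : rectLinkRescale γ⁻¹ (rectLinkRescale γ a) = a :=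
  funext fun e => by simp only [rectLinkRescale_apply, Pi.inv_apply, inv_mul_cancel_left]

/-- `γ·(γ⁻¹·a) = a`. [folklore] -/
theorem rectLinkRescale_rectLinkRescale_inv (γ a : RectSlice Ls G) : rectLinkRescale γ (rectLinkRescale γ⁻¹ a) = a :=
  funext fun e => by simp only [rectLinkRescale_apply, Pi.inv_apply, mul_inv_cancel_left]

/-- 't Hooft's electric twist is the rescaling by its prefactor field. [folklore] -/
theorem rectFluxTwist_eq_rectLinkRescale (z : G) (s : Fin k → ZMod 2) (a : RectSlice Ls G) :
    rectFluxTwist z s a = rectLinkRescale (fun e => rectFluxTwistPrefactor z s e) a := rfl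

/-- **Plaquettes of the rescaled slice**: `U_q(γ·a) = U_q(γ) · U_q(a)` for central `γ` — the coboundary `U_q(γ)` of the
link field appears. [cite: tHooft1979Flux] -/
theorem rectPlaquetteHolonomy_linkRescale {γ : RectSlice Ls G} (hγ : ∀ e, γ e ∈ Subgroup.center G) (a : RectSlice Ls G)
    (x : RectTorusSite Ls) (i j : Fin k) :
    rectPlaquetteHolonomy (rectLinkRescale γ a) x i j = rectPlaquetteHolonomy γ x i j * rectPlaquetteHolonomy a x i j := by
  unfold rectPlaquetteHolonomy
  simp only [rectLinkRescale_apply]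
  have h := central_collect (c₁ := (1 : G) * γ (x, i)) (hγ (x + Pi.single i 1, j)) (hγ (x + Pi.single j 1, i)) (hγ (x, j))
    (a (x, i)) (a (x + Pi.single i 1, j)) (a (x + Pi.single j 1, i)) (a (x, j))
  simpa only [one_mul] using h

variable [∀ i, NeZero (Ls i)]

/-- Temporal plaquettes are blind to a simultaneous central rescaling of both slices. [folklore] -/
theorem rectElecSum_linkRescale {γ : RectSlice Ls G} (hγ : ∀ e, γ e ∈ Subgroup.center G) (a b : RectSlice Ls G)
    (E : RectTorusSite Ls → G) :
    rectElecSum ρ (rectLinkRescale γ a) E (rectLinkRescale γ b) = rectElecSum ρ a E b := by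
  unfold rectElecSum
  refine Finset.sum_congr rfl fun x _ => Finset.sum_congr rfl fun i _ => ?_
  simp only [rectLinkRescale_apply]
  have h := central_collect (c₁ := (1 : G)) (hγ (x, i)) (Subgroup.one_mem _) (hγ (x, i)) (E x) (b (x, i))
    (E (x + Pi.single i 1)) (a (x, i))
  rw [one_mul, one_mul, one_mul, inv_one, mul_one, mul_inv_cancel, one_mul] at h
  rw [h]

/-- **The Wilson magnetic sum as a sum over plaquette holonomies** (the tree's `rectMagSum` unfolded). [folklore] -/
theorem rectMagSum_eq_sum_rectPlaquetteHolonomy (a : RectSlice Ls G) :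
    rectMagSum ρ a = ∑ x : RectTorusSite Ls, ∑ p : {p : Fin k × Fin k // p.1 < p.2},
      (ρ (rectPlaquetteHolonomy a x p.1.1 p.1.2)).trace.re := rfl

/-- A FLAT central field (`U_q(γ) = 1` everywhere: a centre cocycle) leaves the magnetic sum invariant. [cite: tHooft1979Flux] -/
theorem rectMagSum_linkRescale_of_flat {γ : RectSlice Ls G} (hγ : ∀ e, γ e ∈ Subgroup.center G)
    (hflat : ∀ (x : RectTorusSite Ls) (i j : Fin k), i < j → rectPlaquetteHolonomy γ x i j = 1) (a : RectSlice Ls G) :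
    rectMagSum ρ (rectLinkRescale γ a) = rectMagSum ρ a := by
  rw [rectMagSum_eq_sum_rectPlaquetteHolonomy, rectMagSum_eq_sum_rectPlaquetteHolonomy]
  refine Finset.sum_congr rfl fun x _ => Finset.sum_congr rfl fun p _ => ?_
  rw [rectPlaquetteHolonomy_linkRescale hγ, hflat x p.1.1 p.1.2 p.2, one_mul]

variable [TopologicalSpace G] [IsTopologicalGroup G] [CompactSpace G] [MeasurableSpace G] [BorelSpace G]

/-- **A centre cocycle is a symmetry of the slice kernel**: `K(γ·a, γ·b) = K(a, b)` for central flat `γ` (generalises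
`rectSliceKernel_fluxTwist`). [cite: tHooft1979Flux] -/
theorem rectSliceKernel_linkRescale_of_flat {γ : RectSlice Ls G} (hγ : ∀ e, γ e ∈ Subgroup.center G)
    (hflat : ∀ (x : RectTorusSite Ls) (i j : Fin k), i < j → rectPlaquetteHolonomy γ x i j = 1) (JE JM : ℝ)
    (a b : RectSlice Ls G) :
    rectSliceKernel ρ JE JM (rectLinkRescale γ a) (rectLinkRescale γ b) = rectSliceKernel ρ JE JM a b := by
  unfold rectSliceKernel
  simp only [rectMagSum_linkRescale_of_flat ρ hγ hflat, rectElecSum_linkRescale ρ hγ]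

/-- The rescaling preserves the a-priori measure. [folklore] -/
theorem measurePreserving_rectLinkRescale (γ : RectSlice Ls G) :
    MeasurePreserving (rectLinkRescale (Ls := Ls) γ) (rectSliceMeasure G Ls) (rectSliceMeasure G Ls) :=
  measurePreserving_pi (f := fun (e : RectTorusSite Ls × Fin k) (x : G) => γ e * x)
    (fun _ => haarProbability G) (fun _ => haarProbability G)
    fun e => measurePreserving_mul_left (haarProbability G) (γ e)

variable (Ls) in
/-- **The rescaling operator** `V_γ ψ = ψ ∘ (γ·)` on `L²(rectSliceMeasure)` (a linear isometry; `rectFluxTwistOp` is a case). -/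
def rectLinkRescaleOp (γ : RectSlice Ls G) : Lp ℝ 2 (rectSliceMeasure G Ls) →L[ℝ] Lp ℝ 2 (rectSliceMeasure G Ls) :=
  (Lp.compMeasurePreservingₗᵢ ℝ (rectLinkRescale (Ls := Ls) γ) (measurePreserving_rectLinkRescale γ)).toContinuousLinearMap

/-- `V_γ ψ = ψ ∘ (γ·)` a.e. [folklore] -/
theorem rectLinkRescaleOp_ae_eq (γ : RectSlice Ls G) (ψ : Lp ℝ 2 (rectSliceMeasure G Ls)) :
    (rectLinkRescaleOp Ls γ ψ : RectSlice Ls G → ℝ) =ᵐ[rectSliceMeasure G Ls] (ψ : RectSlice Ls G → ℝ) ∘ rectLinkRescale γ :=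
  Lp.coeFn_compMeasurePreserving ψ (measurePreserving_rectLinkRescale γ)

/-- `‖V_γ‖ ≤ 1`. [folklore] -/
theorem norm_rectLinkRescaleOp_le_one (γ : RectSlice Ls G) : ‖rectLinkRescaleOp Ls γ‖ ≤ 1 :=
  ContinuousLinearMap.opNorm_le_bound _ zero_le_one fun ψ => by
    rw [one_mul]; exact (Lp.norm_compMeasurePreserving ψ (measurePreserving_rectLinkRescale γ)).le

/-- `V_γ ∘ V_{γ⁻¹} = 1`. [folklore] -/
theorem rectLinkRescaleOp_comp_inv (γ : RectSlice Ls G) : (rectLinkRescaleOp Ls γ).comp (rectLinkRescaleOp Ls γ⁻¹) = 1 :=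
  compMeasurePreserving_comp_eq_one _ _ (rectLinkRescale_inv_rectLinkRescale γ)

/-- `V_{γ⁻¹} ∘ V_γ = 1`. [folklore] -/
theorem rectLinkRescaleOp_inv_comp (γ : RectSlice Ls G) : (rectLinkRescaleOp Ls γ⁻¹).comp (rectLinkRescaleOp Ls γ) = 1 :=
  compMeasurePreserving_comp_eq_one _ _ (rectLinkRescale_rectLinkRescale_inv γ)

variable [SecondCountableTopology G]

/-- **Every centre cocycle is a symmetry of the tube: `V_γ ∘ T = T ∘ V_γ`** for central flat `γ` (continuous `ρ`; generalises
the flux-twist commutation `C_s ∘ T = T ∘ C_s`). [cite: tHooft1979Flux] [cite: Luscher1977] -/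
theorem rectLinkRescaleOp_comp_rectTubeTransferOperator (hρ : Continuous ρ) (J : ℝ) {γ : RectSlice Ls G}
    (hγ : ∀ e, γ e ∈ Subgroup.center G)
    (hflat : ∀ (x : RectTorusSite Ls) (i j : Fin k), i < j → rectPlaquetteHolonomy γ x i j = 1) :
    (rectLinkRescaleOp Ls γ).comp (rectTubeTransferOperator ρ J Ls) =
      (rectTubeTransferOperator ρ J Ls).comp (rectLinkRescaleOp Ls γ) :=
  comp_kernelOp_eq_of_kernel_comp (measurePreserving_rectLinkRescale γ)
    (stronglyMeasurable_uncurry_rectSliceKernel ρ hρ J J) (rectSliceKernel_linkRescale_of_flat ρ hγ hflat J J)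
    (rectTubeTransferOperator_ae_eq J Ls hρ) (rectTubeTransferOperator_ae_eq J Ls hρ)

end Rescale

end Summit.Ventures.YMGap.FlowData
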